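import Summits.QuantumFields.YangMills.Theorems.UnitScaleTiltProp7CombSymConjugationT3
import Summits.QuantumFields.YangMills.Theorems.BalabanUVNodesN18CombGaugeLetters
import Literature.MathematicalPhysics.QuantumFieldTheory.Balaban1983to89.B12Average05And08
import HarnessLib

/-!
# Route `UnitScaleTilt`, crux K1 «MinimiserStabilityRegPr» (stmt-QuantumFields-19200), route-R E′ (A′)-on-Σ, P-A2-COMB row (β) (★p1 g17 WORD 23 (b)) — file (β-ii): **THE BCH DOOR FOR THE
# DIFFERENCE OF THE COMB AND SYMMETRIC CHART REMAINDERS** — by the exact conjugation ✓`Prop7CombSymConjugation.CmapTw_sub_CmapTwS_eq` and the logarithm of a product to second order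
# ([Balaban1985Averaging] (26)–(27); lit ✓`B12Average05And08.norm_mlog_mul_sub_le`, twice), `C^{tw}(A)(c) − C^{twS}(A)(c) = (log g₋ − ℓ₁) + (log h₊ − ℓ₂) + E_c` with `‖E_c‖ ≤ 4(p+z)² + 4(p+z+pz+q)²`,
# hence `Σ_c‖C^{tw} − C^{twS}‖ ≤ ρ₁ + ρ₂ + Σ_c BCH_c` — the frame-ratio chart remainders `ρ₁ ρ₂`, the linear-part identity and the three sup windows DISPLAYED in their suppliers' currencies

Cell `ym3-torus` (HUMAN RULING D-0037: YM₃ on the torus is ladder rung R3 — not d = 4, not a mass gap, not Clay), width seat `ym3-torus-px18` (gen 3).  `--supports stmt-QuantumFields-19200 --as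
helper`; THEOREMS ONLY (0 `def`, 0 `sorry`); count-neutral.  Kinematics + BCH over landed letters; the analytic sub-rows (frame-ratio chart remainders R1, their ℓ²∕mass sizes, the top-level field
mass) are NOT proved here; nothing of P-A2, hcoS, E′, EX, the crux, d = 4 or the mass gap is claimed.

THE PRINT.  [Balaban1985Averaging] (26)–(27) p. 22 (logarithm of a product of near-identity factors to second order), (89)–(92) p. 31 (the double bar; two frame families differ by a coarse gauge
transformation); [Balaban1985Variational] (44) p. 285 (`C = log U̿ − Q·`).

LETTERS (per member `(F, n, K, h, U₀)`, per exponent `A`; all INLINE): `g y := (frameTw U₀ A y)⁻¹·frameTwS U₀ A y` (coarse-site frame ratio), `U c := ↑U̿^{twS}(A)(c)`,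
`H c := ↑(D̄₀ c·(g c₊)⁻¹·D̄₀ c⁻¹)` (`D̄₀ = descendToGL (bgUnits U₀)`), so that ✓(β-i) reads `log U̿^{tw}(A)(c) = mlog(↑g₋·U c·H c)`.
DISPLAYED HYPOTHESES: (RL) `QTw U₀ A c − QTwS U₀ A c = ℓ₁ c + ℓ₂ c` (the linear part of the conjugation; supplier ✓P-A1 LEG §3 + ✓LEG-COMB ∕ ★routeR-w2 g8 ✓p693280 `r` letters: `Dg(0) = r_s − r_c`);
(Rp)(Rz)(Rq) sup windows `‖↑g y − 1‖ ≤ p y`, `‖U c − 1‖ ≤ z c`, `‖H c − 1‖ ≤ q c`, each `≤ 1∕30` (✓`norm_frameTw_sub_one_le_of_regPr` 192e, ✓`norm_dbarTwS_sub_one_le`, unitary conjugation);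
(R1) `Σ_c‖mlog ↑(g c₋) − ℓ₁ c‖ ≤ ρ₁`, (R2) `Σ_c‖mlog (H c) − ℓ₂ c‖ ≤ ρ₂` (frame-RATIO chart remainders — second order, `ℓ⁻¹M + ℓK` currency after AM–GM per ★p1 WORD 23 (b); comb-frame hands).
WHAT IS PROVED (ns `…Theorems.Prop7CombSymBCHDoor`).
* §1 ★`norm_mlog_mul3_sub_mlog_mid_sub_le` (with ✓`YMDAG.N18.LogConjugation.norm_mul_sub_one_le_of_near` for `‖xy − 1‖ ≤ p + z + pz`) — for `‖G − 1‖ ≤ p`, `‖U − 1‖ ≤ z`, `‖H − 1‖ ≤ q`, `p, z, q ≤ 1∕30`: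
  `‖mlog(G·U·H) − mlog U − (mlog G + mlog H)‖ ≤ 4(p+z)² + 4(p+z+pz+q)²` (lit ✓`norm_mlog_mul_sub_le` twice).
* §2 ★★ `norm_CmapTw_sub_CmapTwS_le` — pointwise: `‖C^{tw}(A)(c) − C^{twS}(A)(c)‖ ≤ ‖mlog ↑g(c₋) − ℓ₁ c‖ + ‖mlog (H c) − ℓ₂ c‖ + 4(p c₋ + z c)² + 4(p c₋ + z c + p c₋·z c + q c)²`.
* §3 ★★★ `sum_norm_CmapTw_sub_CmapTwS_le` — THE DOOR: `Σ_c ‖C^{tw}(A)(c) − C^{twS}(A)(c)‖ ≤ ρ₁ + ρ₂ + Σ_c [4(p c₋ + z c)² + 4(p c₋ + z c + p c₋·z c + q c)²]`.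
HONEST SCOPE.  The quadratic BCH term books in the E2E as `≤ C·Σ(p² + z² + q²)` = frame masses + top-level field mass (`ℓ⁻¹M + ℓ(K+dv)` by F3″'s level-mass law); R1∕R2 are the genuinely
second-order frame rows.  None of these is proved here.

References: T. Bałaban, CMP **98** (1985) 17–51 [Balaban1985Averaging] ((26)–(27) p.22, (89)–(92) p.31); CMP **102** (1985) 277–309 [Balaban1985Variational] ((44) p.285).
-/

set_option autoImplicit false

noncomputable section

open scoped BigOperators Matrix.Norms.L2Operator

namespace Summit.QuantumFields.YangMills.Theorems.Prop7CombSymBCHDoor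

open Literature.MathematicalPhysics.QuantumFieldTheory.Balaban1983to89
open Literature.MathematicalPhysics.QuantumFieldTheory.Balaban1983to89.T3ContinuumYM3Torus
open MatrixLog (mlog)
open T3SectALandauChart (bgUnits)
open B12Average05And08 (norm_mlog_mul_sub_le)
open Summit.QuantumFields.YangMills.Theorems.Prop7SymAvgGL (descendToGL)
open Summit.QuantumFields.YangMills.Theorems.Prop7SymAvgTw (frameTw dbarTw logChartTw QTw CmapTw)
open Summit.QuantumFields.YangMills.Theorems.Prop7SymAvgTwSym (frameTwS dbarTwS logChartTwS QTwS CmapTwS)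
open Summit.QuantumFields.YangMills.Theorems.Prop7CombSymConjugation (CmapTw_sub_CmapTwS_eq)

/-! ## §1 The logarithm of a three-factor product against the middle logarithm, to second order -/

section BCH

variable {𝔸 : Type*} [NormedRing 𝔸] [NormedAlgebra ℂ 𝔸] [CompleteSpace 𝔸]

/-- ★ **`log(G·U·H) − log U = log G + log H + E`, `‖E‖ ≤ 4(p+z)² + 4(p+z+pz+q)²`** for `‖G − 1‖ ≤ p`, `‖U − 1‖ ≤ z`, `‖H − 1‖ ≤ q`, all `≤ 1∕30` (lit ✓`norm_mlog_mul_sub_le` at `(G, U)`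
then at `(G·U, H)`). [cite: Balaban1985Averaging, (26)–(27) p.22] -/
theorem norm_mlog_mul3_sub_mlog_mid_sub_le {G U H : 𝔸} {p z q : ℝ} (hG : ‖G - 1‖ ≤ p) (hU : ‖U - 1‖ ≤ z) (hH : ‖H - 1‖ ≤ q)
    (hp : p ≤ 1 / 30) (hz : z ≤ 1 / 30) (hq : q ≤ 1 / 30) :
    ‖mlog (G * U * H) - mlog U - (mlog G + mlog H)‖ ≤ 4 * (p + z) ^ 2 + 4 * (p + z + p * z + q) ^ 2 := by
  have hp0 : 0 ≤ p := (norm_nonneg _).trans hG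
  have hz0 : 0 ≤ z := (norm_nonneg _).trans hU
  have hGU : ‖G * U - 1‖ ≤ p + z + p * z := YMDAG.N18.LogConjugation.norm_mul_sub_one_le_of_near hG hU
  have hpz : p + z + p * z ≤ 1 / 10 := by nlinarith
  have h1 : ‖mlog (G * U) - mlog G - mlog U‖ ≤ 4 * (p + z) ^ 2 := norm_mlog_mul_sub_le hG hU (by linarith) (by linarith)
  have h2 : ‖mlog (G * U * H) - mlog (G * U) - mlog H‖ ≤ 4 * (p + z + p * z + q) ^ 2 := norm_mlog_mul_sub_le hGU hH hpz (by linarith)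
  have e1 : mlog (G * U * H) - mlog U - (mlog G + mlog H) = (mlog (G * U * H) - mlog (G * U) - mlog H) + (mlog (G * U) - mlog G - mlog U) := by abel
  rw [e1]
  exact (norm_add_le _ _).trans (by linarith)

end BCH

/-! ## §2 Pointwise: the difference of the two chart remainders -/

section Pointwise

variable (F : T3Family) (n K : ℕ) (h : n ≤ K) (U₀ : GaugeField (F.P K) 0 (Matrix.specialUnitaryGroup (Fin 2) ℂ))

/-- ★★ **POINTWISE DIFFERENCE OF THE COMB AND SYMMETRIC CHART REMAINDERS**: with the frame ratio `g = frameTw⁻¹·frameTwS`, `U = U̿^{twS}(A)(c)`, `H = D̄₀(c)·g(c₊)⁻¹·D̄₀(c)⁻¹`, the linear-part identity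
(RL) `QTw A c − QTwS A c = ℓ₁ c + ℓ₂ c` and the sup windows `p z q ≤ 1∕30`:
`‖C^{tw}(A)(c) − C^{twS}(A)(c)‖ ≤ ‖log ↑g(c₋) − ℓ₁ c‖ + ‖log H − ℓ₂ c‖ + 4(p+z)² + 4(p+z+pz+q)²`. [cite: Balaban1985Averaging, (26)–(27) p.22, (89)–(92) p.31; Balaban1985Variational, (44) p.285] -/
theorem norm_CmapTw_sub_CmapTwS_le (A : PBond (F.P K) 0 → Matrix (Fin 2) (Fin 2) ℂ) (c : PBond (F.P n) 0)
    (ℓ₁ ℓ₂ : Matrix (Fin 2) (Fin 2) ℂ) (hRL : QTw F n K h U₀ A c - QTwS F n K h U₀ A c = ℓ₁ + ℓ₂)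
    {p z q : ℝ}
    (hp : ‖(((frameTw F n K h U₀ A c.src)⁻¹ * frameTwS F n K h U₀ A c.src : (Matrix (Fin 2) (Fin 2) ℂ)ˣ) : Matrix (Fin 2) (Fin 2) ℂ) - 1‖ ≤ p)
    (hz : ‖((dbarTwS F n K h U₀ A c : (Matrix (Fin 2) (Fin 2) ℂ)ˣ) : Matrix (Fin 2) (Fin 2) ℂ) - 1‖ ≤ z)
    (hq : ‖((descendToGL F n K h (bgUnits F K U₀) c * ((frameTw F n K h U₀ A c.tgt)⁻¹ * frameTwS F n K h U₀ A c.tgt)⁻¹ * (descendToGL F n K h (bgUnits F K U₀) c)⁻¹ :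
            (Matrix (Fin 2) (Fin 2) ℂ)ˣ) : Matrix (Fin 2) (Fin 2) ℂ) - 1‖ ≤ q)
    (hp' : p ≤ 1 / 30) (hz' : z ≤ 1 / 30) (hq' : q ≤ 1 / 30) :
    ‖CmapTw F n K h U₀ A c - CmapTwS F n K h U₀ A c‖ ≤
      ‖mlog (((frameTw F n K h U₀ A c.src)⁻¹ * frameTwS F n K h U₀ A c.src : (Matrix (Fin 2) (Fin 2) ℂ)ˣ) : Matrix (Fin 2) (Fin 2) ℂ) - ℓ₁‖ +
      ‖mlog ((descendToGL F n K h (bgUnits F K U₀) c * ((frameTw F n K h U₀ A c.tgt)⁻¹ * frameTwS F n K h U₀ A c.tgt)⁻¹ * (descendToGL F n K h (bgUnits F K U₀) c)⁻¹ :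
            (Matrix (Fin 2) (Fin 2) ℂ)ˣ) : Matrix (Fin 2) (Fin 2) ℂ) - ℓ₂‖ +
      (4 * (p + z) ^ 2 + 4 * (p + z + p * z + q) ^ 2) := by
  rw [CmapTw_sub_CmapTwS_eq, hRL]
  have hb := norm_mlog_mul3_sub_mlog_mid_sub_le hp hz hq hp' hz' hq'
  -- `(log(GUH) − log U) − (ℓ₁ + ℓ₂) = (log G − ℓ₁) + (log H − ℓ₂) + E`
  have e1 : ∀ (LGUH LU LG LH l₁ l₂ : Matrix (Fin 2) (Fin 2) ℂ), LGUH - LU - (l₁ + l₂) = (LG - l₁) + (LH - l₂) + (LGUH - LU - (LG + LH)) := by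
    intros; abel
  rw [e1 _ _ (mlog (((frameTw F n K h U₀ A c.src)⁻¹ * frameTwS F n K h U₀ A c.src : (Matrix (Fin 2) (Fin 2) ℂ)ˣ) : Matrix (Fin 2) (Fin 2) ℂ))
    (mlog ((descendToGL F n K h (bgUnits F K U₀) c * ((frameTw F n K h U₀ A c.tgt)⁻¹ * frameTwS F n K h U₀ A c.tgt)⁻¹ * (descendToGL F n K h (bgUnits F K U₀) c)⁻¹ :
            (Matrix (Fin 2) (Fin 2) ℂ)ˣ) : Matrix (Fin 2) (Fin 2) ℂ))]
  exact (norm_add₃_le).trans (add_le_add le_rfl hb)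

end Pointwise

/-! ## §3 ★★★ The door: summed over the coarse bonds -/

section Door

variable (F : T3Family) (n K : ℕ) (h : n ≤ K) (U₀ : GaugeField (F.P K) 0 (Matrix.specialUnitaryGroup (Fin 2) ℂ))

/-- ★★★ **THE (β) DOOR — `Σ_c ‖C^{tw}(A)(c) − C^{twS}(A)(c)‖ ≤ ρ₁ + ρ₂ + Σ_c BCH_c`**: with the linear-part identity (RL) at every coarse bond, the sup windows (Rp)(Rz)(Rq) `≤ 1∕30`, and the two
frame-ratio chart-remainder rows (R1) `Σ_c‖log ↑g(c₋) − ℓ₁ c‖ ≤ ρ₁`, (R2) `Σ_c‖log H_c − ℓ₂ c‖ ≤ ρ₂` DISPLAYED: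
`Σ_c ‖CmapTw U₀ A c − CmapTwS U₀ A c‖ ≤ ρ₁ + ρ₂ + Σ_c (4(p c₋ + z c)² + 4(p c₋ + z c + p c₋·z c + q c)²)` — P-A2-COMB = the symmetric chain (✓F0″ˢ∕F1″∕F2″∕F3″ on `CmapTwS`) + this door; the
quadratic term books as frame masses + top-level field mass (`ℓ⁻¹M + ℓ(K+dv)` by the level-mass law) in the E2E. [cite: Balaban1985Averaging, (26)–(27) p.22, (89)–(92) p.31; Balaban1985Variational, (44) p.285] -/
theorem sum_norm_CmapTw_sub_CmapTwS_le (A : PBond (F.P K) 0 → Matrix (Fin 2) (Fin 2) ℂ)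
    (ℓ₁ ℓ₂ : PBond (F.P n) 0 → Matrix (Fin 2) (Fin 2) ℂ) (hRL : ∀ c, QTw F n K h U₀ A c - QTwS F n K h U₀ A c = ℓ₁ c + ℓ₂ c)
    (p : Site (F.P n) 0 → ℝ) (z q : PBond (F.P n) 0 → ℝ)
    (hp : ∀ y, ‖(((frameTw F n K h U₀ A y)⁻¹ * frameTwS F n K h U₀ A y : (Matrix (Fin 2) (Fin 2) ℂ)ˣ) : Matrix (Fin 2) (Fin 2) ℂ) - 1‖ ≤ p y)
    (hz : ∀ c, ‖((dbarTwS F n K h U₀ A c : (Matrix (Fin 2) (Fin 2) ℂ)ˣ) : Matrix (Fin 2) (Fin 2) ℂ) - 1‖ ≤ z c)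
    (hq : ∀ c, ‖((descendToGL F n K h (bgUnits F K U₀) c * ((frameTw F n K h U₀ A c.tgt)⁻¹ * frameTwS F n K h U₀ A c.tgt)⁻¹ * (descendToGL F n K h (bgUnits F K U₀) c)⁻¹ :
            (Matrix (Fin 2) (Fin 2) ℂ)ˣ) : Matrix (Fin 2) (Fin 2) ℂ) - 1‖ ≤ q c)
    (hp' : ∀ y, p y ≤ 1 / 30) (hz' : ∀ c, z c ≤ 1 / 30) (hq' : ∀ c, q c ≤ 1 / 30)
    {ρ₁ ρ₂ : ℝ}
    (hR1 : ∑ c : PBond (F.P n) 0, ‖mlog (((frameTw F n K h U₀ A c.src)⁻¹ * frameTwS F n K h U₀ A c.src : (Matrix (Fin 2) (Fin 2) ℂ)ˣ) : Matrix (Fin 2) (Fin 2) ℂ) - ℓ₁ c‖ ≤ ρ₁)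
    (hR2 : ∑ c : PBond (F.P n) 0, ‖mlog ((descendToGL F n K h (bgUnits F K U₀) c * ((frameTw F n K h U₀ A c.tgt)⁻¹ * frameTwS F n K h U₀ A c.tgt)⁻¹ * (descendToGL F n K h (bgUnits F K U₀) c)⁻¹ :
            (Matrix (Fin 2) (Fin 2) ℂ)ˣ) : Matrix (Fin 2) (Fin 2) ℂ) - ℓ₂ c‖ ≤ ρ₂) :
    ∑ c : PBond (F.P n) 0, ‖CmapTw F n K h U₀ A c - CmapTwS F n K h U₀ A c‖ ≤
      ρ₁ + ρ₂ + ∑ c : PBond (F.P n) 0, (4 * (p c.src + z c) ^ 2 + 4 * (p c.src + z c + p c.src * z c + q c) ^ 2) := by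
  have hpt : ∀ c : PBond (F.P n) 0, ‖CmapTw F n K h U₀ A c - CmapTwS F n K h U₀ A c‖ ≤
      ‖mlog (((frameTw F n K h U₀ A c.src)⁻¹ * frameTwS F n K h U₀ A c.src : (Matrix (Fin 2) (Fin 2) ℂ)ˣ) : Matrix (Fin 2) (Fin 2) ℂ) - ℓ₁ c‖ +
      ‖mlog ((descendToGL F n K h (bgUnits F K U₀) c * ((frameTw F n K h U₀ A c.tgt)⁻¹ * frameTwS F n K h U₀ A c.tgt)⁻¹ * (descendToGL F n K h (bgUnits F K U₀) c)⁻¹ :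
            (Matrix (Fin 2) (Fin 2) ℂ)ˣ) : Matrix (Fin 2) (Fin 2) ℂ) - ℓ₂ c‖ +
      (4 * (p c.src + z c) ^ 2 + 4 * (p c.src + z c + p c.src * z c + q c) ^ 2) :=
    fun c => norm_CmapTw_sub_CmapTwS_le F n K h U₀ A c (ℓ₁ c) (ℓ₂ c) (hRL c) (hp c.src) (hz c) (hq c) (hp' c.src) (hz' c) (hq' c)
  calc ∑ c : PBond (F.P n) 0, ‖CmapTw F n K h U₀ A c - CmapTwS F n K h U₀ A c‖
      ≤ ∑ c : PBond (F.P n) 0, (‖mlog (((frameTw F n K h U₀ A c.src)⁻¹ * frameTwS F n K h U₀ A c.src : (Matrix (Fin 2) (Fin 2) ℂ)ˣ) : Matrix (Fin 2) (Fin 2) ℂ) - ℓ₁ c‖ +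
          ‖mlog ((descendToGL F n K h (bgUnits F K U₀) c * ((frameTw F n K h U₀ A c.tgt)⁻¹ * frameTwS F n K h U₀ A c.tgt)⁻¹ * (descendToGL F n K h (bgUnits F K U₀) c)⁻¹ :
                (Matrix (Fin 2) (Fin 2) ℂ)ˣ) : Matrix (Fin 2) (Fin 2) ℂ) - ℓ₂ c‖ +
          (4 * (p c.src + z c) ^ 2 + 4 * (p c.src + z c + p c.src * z c + q c) ^ 2)) := Finset.sum_le_sum fun c _ => hpt c
    _ = (∑ c : PBond (F.P n) 0, ‖mlog (((frameTw F n K h U₀ A c.src)⁻¹ * frameTwS F n K h U₀ A c.src : (Matrix (Fin 2) (Fin 2) ℂ)ˣ) : Matrix (Fin 2) (Fin 2) ℂ) - ℓ₁ c‖) +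
        (∑ c : PBond (F.P n) 0, ‖mlog ((descendToGL F n K h (bgUnits F K U₀) c * ((frameTw F n K h U₀ A c.tgt)⁻¹ * frameTwS F n K h U₀ A c.tgt)⁻¹ * (descendToGL F n K h (bgUnits F K U₀) c)⁻¹ :
                (Matrix (Fin 2) (Fin 2) ℂ)ˣ) : Matrix (Fin 2) (Fin 2) ℂ) - ℓ₂ c‖) +
        ∑ c : PBond (F.P n) 0, (4 * (p c.src + z c) ^ 2 + 4 * (p c.src + z c + p c.src * z c + q c) ^ 2) := by
          rw [Finset.sum_add_distrib, Finset.sum_add_distrib]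
    _ ≤ ρ₁ + ρ₂ + ∑ c : PBond (F.P n) 0, (4 * (p c.src + z c) ^ 2 + 4 * (p c.src + z c + p c.src * z c + q c) ^ 2) := by linarith

end Door


end Summit.QuantumFields.YangMills.Theorems.Prop7CombSymBCHDoor

end
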